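import Summits.QuantumFields.BalabanUV.T4Continuum.Support.NE3GaugeDirFrames
import Summits.QuantumFields.BalabanUV.T4Continuum.Support.NE3TangentCovariantTower
import Summits.QuantumFields.BalabanUV.T4Continuum.Support.SkeletonLattice
import HarnessLib

/-!
# NE3CovariantBlockMean (T⁴ programme, node NE3, row K0a of the owner's ruling ρ-g22-2, file 1∕2) — THE TRANSPORTED BLOCK MEAN
# `bmeanW`, ITS NESTING `bmeanIterW` THROUGH THE AVERAGING TOWER, THE CURVED (‡)
# `framePotW L k W (gaugeDir W μ) z = μ (L^k•z) − bmeanIterW L k W μ z` (EXACT), AND THE TRANSPORTED CORNER GAUGE `liftW`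

NE3 (node U1b) formalisation swarm `b2b-balaban-t4-ne3-formalise-*`, leaf seat `b2b-balaban-t4-ne3-formalise-leaf-02` (gen 5), row
**K0** of the owner's ruling ρ-g22-2 (route H♮, design memo `HOME/t4/b2b-balaban-t4-ne3-p1/g22/D-ne3p1-g22-1.md`: «`T_♮(W)` as a Set at
curved W + Φ6-W + min-norm at W → leaf-02-g5 ∕ leaf-01-g5»), sub-row **K0a = the curved frame-kill** (INTENT `HOME/CLAIMS.log`
2026-08-20T16:48Z).  WHY.  Route H♮'s curved step lives on the FRAME-FREE slice `T_♮(W)` (`framePotW = 0`, ρ-g21-3 (V6) ∕ ρ-g22-2 (V3):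
S3 «`ψ′ = −bmean_W ζ′`, NO frame potential»); the chart's L1 representative must therefore be movable INTO `{framePotW = 0}` by a
CORNER-TRIVIAL gauge at a CURVED background — the `W ≠ 1` analogue of row NE3-R2's Φ1a `NE3FramePotGauge.exists_frameFree_repr`,
whose flat mechanism was the identity (‡) `framePot L k (dPot ξ) z = (bmean L)^[k] ξ z − ξ(L^k•z)`.  THIS FILE gives the curved (‡) —
EXACT, no perturbation argument — over leaf-04's covariant kinematics BY NAME (`NE3GaugeDirFrames.Fbar_gaugeDir` ∕ `Qbar_gaugeDir`:
the one-level frame and double-bar average of a gauge direction telescope onto the TRANSPORTED block average of the generator;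
`NE3TangentCovariantTower`: the tower class, `framePotW_succ`, `step_small`).  All [folklore], 0 sorry; three DATA defs
(`bmeanW`, `bmeanIterW`, `liftW`), no `def … : Prop`:
§1 **`bmeanW L W μ z := Σ_r L^{−d}•Ad_{W(Γ_{L•z,L•z+r})} μ(L•z + r)`** (the transported block mean; leaf-04's inline sum, named),
   **`bmeanIterW`** (`bmeanIterW L 0 W μ = μ`, `bmeanIterW L (j+1) W μ = bmeanIterW L j (cavg L W) (bmeanW L W μ)` — one transported
   `L`-block mean per level at the successively averaged backgrounds), `Fbar_gaugeDir_eq` ∕ `Qbar_gaugeDir_eq` (leaf-04's identities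
   re-read);
§2 `bmeanW_mem_skewAdjoint`, `bmeanW_add_period`, **`bmeanIterW_skew_periodic`** (in the multi-level small-field class of
   `dirIter_gaugeDir` the averaged backgrounds stay unitary, so the nested mean of a skew `tower`-periodic field is skew and `M`-periodic);
§3 **`framePotW_gaugeDir`** — THE CURVED (‡): in the class (unitary `W` of period `tower L M (j+1)`, `0 ≤ x`, `LevelSmall d L j x`,
   `SmallField W x`), for a skew `(tower L M (j+1))`-periodic `μ`:
   `framePotW L (j+1) W (gaugeDir W μ) z = μ ((L^(j+1))•z) − bmeanIterW L (j+1) W μ z` — the intermediate corner readings of the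
   recursion `framePotW_succ` telescope away, exactly; at `W = 1` it is NE3-R2's `framePot_dPot` (`gaugeDir 1 μ = −dPot μ`, `bmean`);
§4 **`liftW L W m`** (the transported corner gauge: `0` on `L•ℤ^d`, `(L^d∕(L^d−1))•Ad_{W(Γ)}⁻¹ (m (cdiv L x))` off it), `liftW_corner`,
   `liftW_mem_skewAdjoint`, `liftW_add_period`, and **`bmeanW_liftW : bmeanW L W (liftW L W m) = m`** (`L ≥ 1`, `L^d ≥ 2`) — an EXACT
   right inverse of the transported block mean on fields vanishing on the `L`-lattice (the transports cancel path by path,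
   `NE3GaugeDirFrames.Ad_Ad_inv`).
File 2 `NE3CurvedFrameKill`: `framePotW_add` ∕ `_skew_periodic`, the onto-ness of `bmeanIterW` down the tower, and the CURVED FRAME-KILL
`exists_frameFreeW_repr`.
HONEST FRAMING.  Exact kinematics of OUR linearised averaging at a fixed background in the small-field class; nothing about Bałaban's
minimisers; the Set `T_♮(W)`, Φ6-W, (P♮)_W, (ML_w) at `W ≠ 1`, T-E_w and NE3 are NOT proved here; spine PROVED 0∕9; finite T⁴ rung
(B)+1 — NOT infinite volume, NOT mass gap, NOT BetaPertH, NOT Clay.  ABSOLUTE RULE kept: no printed sentence is a hypothesis (context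
only: [Balaban1985Averaging] (42)–(48) pp. 23–25, (110)–(125) pp. 31–36).  PLACEMENT: `Summits/QuantumFields/BalabanUV/`; imports
leaf-04's `NE3GaugeDirFrames` ∕ `NE3TangentCovariantTower` and the tree's `SkeletonLattice` BY NAME; moves nothing.  HONEST
DEPENDENCY: continuum YM on T⁴ ⇐ BetaPertH ∧ nine spine estimates (0/9 proved); BetaPertH ⇐ (D1) ∧ (D4) ∧ CAP+tail; G-an2-4 gates
asym, D1 and NE2/3/4.
-/

set_option autoImplicit false

open scoped BigOperators Matrix.Norms.L2Operator
open Finset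

namespace Summit.QuantumFields.BalabanUV.T4Continuum.NE3CovariantBlockMean

open Literature.MathematicalPhysics.QuantumFieldTheory.Balaban1983to89
open B7Prop1Explicit B7Prop2Explicit
open T4AveragingDeficitWall (IsUnitaryCfg IsSkewDir SmallField Ad)
open T4AveragingDeficitWallBoundary (IsPeriodicCfg periodBox mem_periodBox)
open T4AveragingDeficitNonAbelian (hol_add_period)
open AveragingDeficitPeriodicCounting (IsPeriodicDir)
open AveragingDeficitTransport (Ad_mem_skewAdjoint)
open AveragingDeficitNearIdentity (Ad_real_smul Ad_zero)
open AveragingDeficitChartCalculus (cavg)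
open AveragingDeficitMultiLevelPrep (cavgIter tower LevelSmall natCast_tower_succ tower_ne_zero)
open AveragingDeficitFermat (isPeriodicCfg_cavg)
open BlockAveragePushDirGauge (gaugeDir)
open NE3TangentCovariantStructure (Qbar Fbar)
open NE3TangentCovariantTower (framePotW framePotW_one framePotW_succ step_small)
open NE3GaugeDirFrames (Fbar_gaugeDir Qbar_gaugeDir Ad_Ad_inv)
open SkeletonLattice (cdiv cmod smul_cdiv_add_cmod cdiv_eq_of_repr cmod_eq_of_repr cdiv_add_period cmod_add_period)

noncomputable section

variable {d : ℕ} {n : Type*} [Fintype n] [DecidableEq n]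

/-! ## §1 The transported block mean and its nesting through the tower -/

/-- **THE TRANSPORTED BLOCK MEAN** of a site field at the background `W`, read on the coarse unit lattice:
`bmeanW L W μ z = Σ_{r∈[0,L)^d} L^{−d}·Ad_{W(Γ_{L•z, L•z+r})} μ(L•z + r)` (parallel transport along the tree words `treeWord r` of
[Balaban1985Averaging] (42) to the block corner; the flat `NE3FramePotGauge.bmean` at `W = 1`). [folklore] -/
def bmeanW (L : ℕ) (W : Site d → Fin d → (Matrix n n ℂ)ˣ) (mu : Site d → (Matrix n n ℂ)) : Site d → (Matrix n n ℂ) :=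
  fun z => ∑ r : Fin d → Fin L, (((L : ℝ) ^ d)⁻¹ : ℝ) • Ad (hol W ((L : ℤ) • z) (treeWord (boxVec L r))) (mu ((L : ℤ) • z + boxVec L r))

/-- **THE NESTED TRANSPORTED BLOCK MEAN THROUGH THE TOWER**: `bmeanIterW L 0 W μ = μ`,
`bmeanIterW L (j+1) W μ = bmeanIterW L j (cavg L W) (bmeanW L W μ)` (one transported `L`-block mean per level, at the successive
averaged backgrounds `W, cavg L W, …`; NOT a single-scale object at a curved `W`). [folklore] -/
def bmeanIterW (L : ℕ) : ℕ → (Site d → Fin d → (Matrix n n ℂ)ˣ) → (Site d → (Matrix n n ℂ)) → Site d → (Matrix n n ℂ)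
  | 0, _, mu => mu
  | j + 1, W, mu => bmeanIterW L j (cavg L W) (bmeanW L W mu)

/-- `bmeanIterW L 0 W μ = μ`. [folklore] -/
@[simp] theorem bmeanIterW_zero (L : ℕ) (W : Site d → Fin d → (Matrix n n ℂ)ˣ) (mu : Site d → (Matrix n n ℂ)) : bmeanIterW L 0 W mu = mu := rfl

/-- The recursion of `bmeanIterW`. [folklore] -/
theorem bmeanIterW_succ (L j : ℕ) (W : Site d → Fin d → (Matrix n n ℂ)ˣ) (mu : Site d → (Matrix n n ℂ)) :
    bmeanIterW L (j + 1) W mu = bmeanIterW L j (cavg L W) (bmeanW L W mu) := rfl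

/-- leaf-04's `Fbar_gaugeDir` read with the named block mean: `Fbar L W (gaugeDir W μ) z = μ (L•z) − bmeanW L W μ z` (`L ≥ 1`). [folklore] -/
theorem Fbar_gaugeDir_eq {L : ℕ} (hL : 1 ≤ L) (W : Site d → Fin d → (Matrix n n ℂ)ˣ) (mu : Site d → (Matrix n n ℂ)) (z : Site d) :
    Fbar L W (gaugeDir W mu) z = mu ((L : ℤ) • z) - bmeanW L W mu z :=
  Fbar_gaugeDir hL W mu z

/-- leaf-04's `Qbar_gaugeDir` read with the named block mean (small-field class of `cpush_gaugeDir`):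
`Qbar L W (gaugeDir W μ) = gaugeDir (cavg L W) (bmeanW L W μ)`. [folklore] -/
theorem Qbar_gaugeDir_eq [Nonempty n] {L M : ℕ} [NeZero M] [NeZero (L * M)] (hL : 1 ≤ L) {W : Site d → Fin d → (Matrix n n ℂ)ˣ}
    (hWu : IsUnitaryCfg W) (hWP : IsPeriodicCfg W ((L * M : ℕ) : ℤ)) {a : ℝ} (ha : 0 ≤ a)
    (hsmall : 512 * (d + 1) * (d + 4) * (L : ℝ) ^ 2 * a ≤ 1) (hWa : SmallField W a)
    {mu : Site d → (Matrix n n ℂ)} (hmu : ∀ x, mu x ∈ skewAdjoint (Matrix n n ℂ))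
    (hmuP : ∀ (x : Site d) (i : Fin d), mu (x + ((L * M : ℕ) : ℤ) • e i) = mu x) :
    Qbar L W (gaugeDir W mu) = gaugeDir (cavg L W) (bmeanW L W mu) :=
  Qbar_gaugeDir (M := M) hL hWu hWP ha hsmall hWa hmu hmuP

/-! ## §2 Skewness and periodicity of the block means -/

/-- The transported block mean of a 𝔲(n)-valued field at a unitary background is 𝔲(n)-valued. [folklore] -/
theorem bmeanW_mem_skewAdjoint (L : ℕ) {W : Site d → Fin d → (Matrix n n ℂ)ˣ} (hWu : IsUnitaryCfg W) {mu : Site d → (Matrix n n ℂ)}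
    (hmu : ∀ x, mu x ∈ skewAdjoint (Matrix n n ℂ)) (z : Site d) : bmeanW L W mu z ∈ skewAdjoint (Matrix n n ℂ) := by
  unfold bmeanW
  refine (skewAdjoint (Matrix n n ℂ)).sum_mem fun r _ => skewAdjoint.smul_mem _ ?_
  exact Ad_mem_skewAdjoint (hol_mem_of hWu _ _) (hmu _)

/-- The transported block mean of an `(L·P)`-periodic field at an `(L·P)`-periodic background is `P`-periodic. [folklore] -/
theorem bmeanW_add_period (L : ℕ) {W : Site d → Fin d → (Matrix n n ℂ)ˣ} {P : ℤ} (hWP : IsPeriodicCfg W ((L : ℤ) * P))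
    {mu : Site d → (Matrix n n ℂ)} (hmuP : ∀ (x : Site d) (i : Fin d), mu (x + ((L : ℤ) * P) • e i) = mu x) (z : Site d) (i : Fin d) :
    bmeanW L W mu (z + P • e i) = bmeanW L W mu z := by
  unfold bmeanW
  refine Finset.sum_congr rfl fun r _ => ?_
  have h1 : (L : ℤ) • (z + P • e i) = (L : ℤ) • z + ((L : ℤ) * P) • e i := by rw [smul_add, smul_smul]
  rw [h1, hol_add_period hWP i, add_right_comm, hmuP]

/-- **THE NESTED BLOCK MEAN IS 𝔲(n)-VALUED AND PERIODIC THROUGH THE TOWER** (multi-level small-field class of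
`NE3TangentCovariantTower.dirIter_gaugeDir`: unitary `W` of period `tower L M (j+1)`, `0 ≤ x`, `LevelSmall d L j x`, `SmallField W x` —
the averaged backgrounds stay unitary): for a skew `(tower L M (j+1))`-periodic `μ`, `bmeanIterW L (j+1) W μ` is skew and `M`-periodic.
[folklore] -/
theorem bmeanIterW_skew_periodic [Nonempty n] {L M : ℕ} [NeZero M] (hL : 1 ≤ L) (j : ℕ) :
    ∀ {W : Site d → Fin d → (Matrix n n ℂ)ˣ} {x : ℝ}, IsUnitaryCfg W → IsPeriodicCfg W ((tower L M (j + 1) : ℕ) : ℤ) → 0 ≤ x →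
    LevelSmall d L j x → SmallField W x → ∀ {mu : Site d → (Matrix n n ℂ)}, (∀ y, mu y ∈ skewAdjoint (Matrix n n ℂ)) →
    (∀ (y : Site d) (i : Fin d), mu (y + ((tower L M (j + 1) : ℕ) : ℤ) • e i) = mu y) →
      (∀ z, bmeanIterW L (j + 1) W mu z ∈ skewAdjoint (Matrix n n ℂ)) ∧
        ∀ (z : Site d) (i : Fin d), bmeanIterW L (j + 1) W mu (z + (M : ℤ) • e i) = bmeanIterW L (j + 1) W mu z := by
  induction j with
  | zero =>
      intro W x hWu hWP _ _ _ mu hmu hmuP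
      have hWP' : IsPeriodicCfg W ((L : ℤ) * (tower L M 0 : ℕ)) := by rw [← natCast_tower_succ]; exact hWP
      have hmuP' : ∀ (y : Site d) (i : Fin d), mu (y + ((L : ℤ) * (tower L M 0 : ℕ)) • e i) = mu y := by
        intro y i; rw [← natCast_tower_succ]; exact hmuP y i
      rw [zero_add, bmeanIterW_succ, bmeanIterW_zero]
      refine ⟨bmeanW_mem_skewAdjoint L hWu hmu, fun z i => ?_⟩
      have h := bmeanW_add_period L hWP' hmuP' z i
      simpa [tower] using h
  | succ j ih =>
      intro W x hWu hWP hx hs hWx mu hmu hmuP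
      have hWP' : IsPeriodicCfg W ((L : ℤ) * (tower L M (j + 1) : ℕ)) := by rw [← natCast_tower_succ]; exact hWP
      have hmuP' : ∀ (y : Site d) (i : Fin d), mu (y + ((L : ℤ) * (tower L M (j + 1) : ℕ)) • e i) = mu y := by
        intro y i; rw [← natCast_tower_succ]; exact hmuP y i
      obtain ⟨_, hW₁u, hr0, hW₁x⟩ := step_small hL hWu hx hs.1 hWx
      have hW₁P : IsPeriodicCfg (cavg L W) ((tower L M (j + 1) : ℕ) : ℤ) := isPeriodicCfg_cavg L _ hWP'
      have hm₁ : ∀ y, bmeanW L W mu y ∈ skewAdjoint (Matrix n n ℂ) := bmeanW_mem_skewAdjoint L hWu hmu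
      have hm₁P : ∀ (y : Site d) (i : Fin d), bmeanW L W mu (y + ((tower L M (j + 1) : ℕ) : ℤ) • e i) = bmeanW L W mu y :=
        bmeanW_add_period L hWP' hmuP'
      rw [bmeanIterW_succ]
      exact ih hW₁u hW₁P hr0 hs.2 hW₁x hm₁ hm₁P

/-! ## §3 The curved (‡): the accumulated frames of a gauge direction are coarse-exact up to the nested block mean -/

/-- **THE CURVED (‡), EXACT**: in the multi-level small-field class (unitary `W` of period `tower L M (j+1)`, `0 ≤ x`,
`LevelSmall d L j x`, `SmallField W x`) and for a skew `(tower L M (j+1))`-periodic generator `μ`,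
`framePotW L (j+1) W (gaugeDir W μ) z = μ ((L^(j+1))•z) − bmeanIterW L (j+1) W μ z` — the accumulated linearised frames of a gauge
direction are the generator at the corner minus its NESTED TRANSPORTED BLOCK MEAN; the intermediate corner readings telescope away
(induction on the tower: leaf-04's `Fbar_gaugeDir` ∕ `Qbar_gaugeDir` at each level).  At `W = 1` this is row NE3-R2's
`NE3FramePotGauge.framePot_dPot`. [folklore] -/
theorem framePotW_gaugeDir [Nonempty n] {L M : ℕ} [NeZero M] (hL : 1 ≤ L) (j : ℕ) :
    ∀ {W : Site d → Fin d → (Matrix n n ℂ)ˣ} {x : ℝ}, IsUnitaryCfg W → IsPeriodicCfg W ((tower L M (j + 1) : ℕ) : ℤ) → 0 ≤ x →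
    LevelSmall d L j x → SmallField W x → ∀ {mu : Site d → (Matrix n n ℂ)}, (∀ y, mu y ∈ skewAdjoint (Matrix n n ℂ)) →
    (∀ (y : Site d) (i : Fin d), mu (y + ((tower L M (j + 1) : ℕ) : ℤ) • e i) = mu y) →
      ∀ z : Site d, framePotW L (j + 1) W (gaugeDir W mu) z = mu (((L : ℤ) ^ (j + 1)) • z) - bmeanIterW L (j + 1) W mu z := by
  haveI : NeZero L := ⟨by omega⟩
  induction j with
  | zero =>
      intro W x _ _ _ _ _ mu _ _ z
      rw [zero_add, framePotW_one, pow_one, bmeanIterW_succ, bmeanIterW_zero]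
      exact Fbar_gaugeDir_eq hL W mu z
  | succ j ih =>
      intro W x hWu hWP hx hs hWx mu hmu hmuP z
      haveI : NeZero (L * tower L M (j + 1)) := ⟨tower_ne_zero L M (j + 2)⟩
      obtain ⟨h512, hW₁u, hr0, hW₁x⟩ := step_small hL hWu hx hs.1 hWx
      have hWP' : IsPeriodicCfg W ((L : ℤ) * (tower L M (j + 1) : ℕ)) := by rw [← natCast_tower_succ]; exact hWP
      have hWPLM : IsPeriodicCfg W ((L * tower L M (j + 1) : ℕ) : ℤ) := by
        have : ((L * tower L M (j + 1) : ℕ) : ℤ) = ((tower L M (j + 1 + 1) : ℕ) : ℤ) := by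
          rw [natCast_tower_succ]; push_cast; ring
        rw [this]; exact hWP
      have hmuPLM : ∀ (y : Site d) (i : Fin d), mu (y + ((L * tower L M (j + 1) : ℕ) : ℤ) • e i) = mu y := by
        intro y i
        have : ((L * tower L M (j + 1) : ℕ) : ℤ) = ((tower L M (j + 1 + 1) : ℕ) : ℤ) := by
          rw [natCast_tower_succ]; push_cast; ring
        rw [this]; exact hmuP y i
      have hmuP' : ∀ (y : Site d) (i : Fin d), mu (y + ((L : ℤ) * (tower L M (j + 1) : ℕ)) • e i) = mu y := by
        intro y i; rw [← natCast_tower_succ]; exact hmuP y i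
      have hW₁P : IsPeriodicCfg (cavg L W) ((tower L M (j + 1) : ℕ) : ℤ) := isPeriodicCfg_cavg L _ hWP'
      have hm₁ : ∀ y, bmeanW L W mu y ∈ skewAdjoint (Matrix n n ℂ) := bmeanW_mem_skewAdjoint L hWu hmu
      have hm₁P : ∀ (y : Site d) (i : Fin d), bmeanW L W mu (y + ((tower L M (j + 1) : ℕ) : ℤ) • e i) = bmeanW L W mu y :=
        bmeanW_add_period L hWP' hmuP'
      have hrec : framePotW L (j + 1 + 1) W (gaugeDir W mu) z
          = framePotW L (j + 1) (cavg L W) (Qbar L W (gaugeDir W mu)) z + Fbar L W (gaugeDir W mu) (((L : ℤ) ^ (j + 1)) • z) := by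
        rw [framePotW_succ]
      have hpow : (L : ℤ) • (((L : ℤ) ^ (j + 1)) • z) = ((L : ℤ) ^ (j + 1 + 1)) • z := by
        rw [smul_smul, ← pow_succ']
      rw [hrec, Qbar_gaugeDir_eq (M := tower L M (j + 1)) hL hWu hWPLM hx h512 hWx hmu hmuPLM,
        ih hW₁u hW₁P hr0 hs.2 hW₁x hm₁ hm₁P z, Fbar_gaugeDir_eq hL W mu, hpow, bmeanIterW_succ L (j + 1) W mu]
      abel

/-! ## §4 The transported corner gauge: an exact right inverse of the transported block mean -/

/-- **THE TRANSPORTED CORNER GAUGE** of a coarse field `m`: `0` on the corner lattice `L•ℤ^d`, and at `x = L•z + q`, `q ∈ [0,L)^d ∖ {0}`,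
the value `(L^d∕(L^d−1))·Ad_{W(Γ_{L•z,x})}⁻¹ (m z)` (the flat `NE3FramePotGauge.cornerGauge` dressed by parallel transport). [folklore] -/
def liftW (L : ℕ) (W : Site d → Fin d → (Matrix n n ℂ)ˣ) (m : Site d → (Matrix n n ℂ)) (x : Site d) : (Matrix n n ℂ) :=
  if cmod L x = 0 then 0 else
    ((((L : ℝ) ^ d) / (((L : ℝ) ^ d) - 1)) : ℝ) • Ad (hol W ((L : ℤ) • cdiv L x) (treeWord (cmod L x)))⁻¹ (m (cdiv L x))

omit [Fintype n] [DecidableEq n] in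
/-- The box vector of `r` has coordinates in `[0, L)`. [folklore] -/
theorem boxVec_bounds (L : ℕ) (r : Fin d → Fin L) (i : Fin d) : 0 ≤ boxVec L r i ∧ boxVec L r i < L := by
  simp only [boxVec]
  exact ⟨by exact_mod_cast Nat.zero_le _, by exact_mod_cast (r i).isLt⟩

omit [Fintype n] [DecidableEq n] in
/-- `cdiv`∕`cmod` of a block point `L•z + boxVec L r`. [folklore] -/
theorem cdiv_cmod_block (L : ℕ) (z : Site d) (r : Fin d → Fin L) :
    cdiv L ((L : ℤ) • z + boxVec L r) = z ∧ cmod L ((L : ℤ) • z + boxVec L r) = boxVec L r :=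
  ⟨cdiv_eq_of_repr rfl (fun i => (boxVec_bounds L r i).1) (fun i => (boxVec_bounds L r i).2),
    cmod_eq_of_repr rfl (fun i => (boxVec_bounds L r i).1) (fun i => (boxVec_bounds L r i).2)⟩

/-- `liftW` vanishes on the corner lattice. [folklore] -/
theorem liftW_corner (L : ℕ) (hL : 1 ≤ L) (W : Site d → Fin d → (Matrix n n ℂ)ˣ) (m : Site d → (Matrix n n ℂ)) (w : Site d) :
    liftW L W m ((L : ℤ) • w) = 0 := by
  have h : cmod L ((L : ℤ) • w) = 0 :=
    cmod_eq_of_repr (z := w) (q := 0) (by rw [add_zero]) (fun _ => le_rfl)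
      (fun _ => by simp only [Pi.zero_apply]; exact_mod_cast (by omega : 0 < L))
  unfold liftW
  rw [if_pos h]

/-- `liftW` of a 𝔲(n)-valued coarse field at a unitary background is 𝔲(n)-valued. [folklore] -/
theorem liftW_mem_skewAdjoint (L : ℕ) {W : Site d → Fin d → (Matrix n n ℂ)ˣ} (hWu : IsUnitaryCfg W) {m : Site d → (Matrix n n ℂ)}
    (hm : ∀ z, m z ∈ skewAdjoint (Matrix n n ℂ)) (x : Site d) : liftW L W m x ∈ skewAdjoint (Matrix n n ℂ) := by
  unfold liftW
  split_ifs
  · exact (skewAdjoint (Matrix n n ℂ)).zero_mem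
  · exact skewAdjoint.smul_mem _ (Ad_mem_skewAdjoint ((unitaryUnits (Matrix n n ℂ)).inv_mem (hol_mem_of hWu _ _)) (hm _))

/-- `liftW` of a `P`-periodic coarse field at an `(L·P)`-periodic background is `(L·P)`-periodic (`L ≥ 1`). [folklore] -/
theorem liftW_add_period {L : ℕ} (hL : 1 ≤ L) {W : Site d → Fin d → (Matrix n n ℂ)ˣ} {P : ℤ} (hWP : IsPeriodicCfg W ((L : ℤ) * P))
    {m : Site d → (Matrix n n ℂ)} (hmP : ∀ (z : Site d) (i : Fin d), m (z + P • e i) = m z) (x : Site d) (i : Fin d) :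
    liftW L W m (x + ((L : ℤ) * P) • e i) = liftW L W m x := by
  unfold liftW
  rw [cmod_add_period, cdiv_add_period hL, smul_add, smul_smul, hol_add_period hWP i, hmP]

/-- **THE TRANSPORTED BLOCK MEAN OF THE TRANSPORTED CORNER GAUGE IS THE DATUM**: `bmeanW L W (liftW L W m) = m`
(`L ≥ 1`, `L^d ≥ 2`: the transports cancel path by path, `Ad_u (Ad_{u⁻¹} X) = X`, and `L^d − 1` sites carry the weight). [folklore] -/
theorem bmeanW_liftW {L : ℕ} (hL : 1 ≤ L) (hLd : 2 ≤ L ^ d) (W : Site d → Fin d → (Matrix n n ℂ)ˣ) (m : Site d → (Matrix n n ℂ)) :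
    bmeanW L W (liftW L W m) = m := by
  haveI : NeZero L := ⟨by omega⟩
  funext z
  set r₀ : Fin d → Fin L := fun _ => ⟨0, by omega⟩ with hr₀
  have hbv0 : ∀ r : Fin d → Fin L, boxVec L r = 0 ↔ r = r₀ := by
    intro r
    constructor
    · intro h; funext i
      have := congr_fun h i
      simp only [boxVec, Pi.zero_apply, Nat.cast_eq_zero] at this
      exact Fin.ext (by simpa [hr₀] using this)
    · rintro rfl; funext i; simp [boxVec, hr₀]
  set c : ℝ := ((L : ℝ) ^ d) / (((L : ℝ) ^ d) - 1) with hc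
  have hterm : ∀ r : Fin d → Fin L,
      (((L : ℝ) ^ d)⁻¹ : ℝ) • Ad (hol W ((L : ℤ) • z) (treeWord (boxVec L r))) (liftW L W m ((L : ℤ) • z + boxVec L r))
        = if r = r₀ then 0 else ((((L : ℝ) ^ d)⁻¹ * c : ℝ)) • m z := by
    intro r
    obtain ⟨hcd, hcm⟩ := cdiv_cmod_block L z r
    unfold liftW
    rw [hcm, hcd]
    by_cases hr : r = r₀
    · rw [if_pos ((hbv0 r).mpr hr), if_pos hr, Ad_zero, smul_zero]
    · rw [if_neg (fun h => hr ((hbv0 r).mp h)), if_neg hr, Ad_real_smul, Ad_Ad_inv, smul_smul]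
  unfold bmeanW
  rw [Finset.sum_congr rfl fun r _ => hterm r, Finset.sum_ite, Finset.sum_const_zero, zero_add, Finset.sum_const,
    Finset.filter_ne' Finset.univ r₀, Finset.card_erase_of_mem (Finset.mem_univ _), Finset.card_univ, Fintype.card_fun,
    Fintype.card_fin, Fintype.card_fin, ← Nat.cast_smul_eq_nsmul ℝ, smul_smul]
  have hLd' : (2 : ℝ) ≤ (L : ℝ) ^ d := by exact_mod_cast hLd
  have hne : ((L : ℝ) ^ d) - 1 ≠ 0 := by linarith
  have hne0 : ((L : ℝ) ^ d) ≠ 0 := by linarith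
  have hcoef : (((L ^ d - 1 : ℕ) : ℝ)) * ((((L : ℝ) ^ d)⁻¹ * c : ℝ)) = 1 := by
    rw [Nat.cast_sub (by omega : 1 ≤ L ^ d)]
    push_cast
    rw [hc]
    field_simp
  rw [hcoef, one_smul]

end

end Summit.QuantumFields.BalabanUV.T4Continuum.NE3CovariantBlockMean
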